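import Literature.Analysis.FluidPDE.TaoBoundedTotalSpeed
import Literature.Analysis.FluidPDE.TaoDuhamelSpeedMajorant
import Literature.Analysis.FluidPDE.TaoDuhamelSpeedPointwise
import HarnessLib

/-!
# Tao (2011/2013), Prop. 9.1: discharge of `tao2011_duhamelNonlinearSpeed_unit` (assembly)

Last file of the discharge of the named fact
`Literature.Analysis.FluidPDE.tao2011_duhamelNonlinearSpeed_unit` (`TaoBoundedTotalSpeed.lean`;
Tao 2011, arXiv:1108.1165, Prop. 9.1 = arXiv Prop. 52, proof pp. 27–28, `ν = 1`, `f = 0`): for a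
classical solution of Navier–Stokes on the closed slab `[0, T] × ℝ³` with `sup_t ∫|u(t)|² ≤ 2E` and
`∫₀ᵀ∫|∇u|²_F ≤ E`, the non-free component obeys `∫₀ᵀ ‖u(t) − e^{tΔ}u(0)‖_{L^∞} dt ≤ K E`.

The two proved inputs of the tree are assembled:

* the **pointwise Fourier majorant** of the non-free component
  (`enorm_sub_heatExtension_le_speedMajorant`, `TaoDuhamelSpeedPointwise.lean`: the tested Duhamel
  formula (9.2) against the Leray-projected heat kernels, Tao's "(energy-decay), bounding `P∇` by `N`"),
  `‖u(t,x₀) − e^{tΔ}u(0)(x₀)‖ ≤ 2π M(t)` for every `x₀`, hence `‖u(t) − e^{tΔ}u(0)‖_{L^∞} ≤ 2π M(t)`;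
* the **time integral of the majorant** (`lintegral_lintegral_speedMajorant_le`,
  `TaoDuhamelSpeedMajorant.lean`: "interchanging integrals and evaluating the `t` integral" and the
  Schur-test conclusion, in continuous frequency), `∫₀ᵀ M ≤ (6S/(2π)⁴) ∫₀ᵀ∫|∇u|²_F`, applied to
  the solution clamped in time to `[0, T]` (jointly continuous on `ℝ × ℝ³`, equal to `u` on `(0, T)`).

Hence `tao2011_duhamelNonlinearSpeed_unit_holds` with `K = 6S/(2π)³`, `S = schurConst`, and the two
corollaries already reduced to it in `TaoBoundedTotalSpeed.lean`: the a priori and the printed form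
of Prop. 9.1 at unit viscosity (`tao2011_boundedTotalSpeed_apriori_unit_holds`,
`tao2011_boundedTotalSpeed_unit_holds`, the latter with Lemma 8.1,
`tao_finite_energy_smooth_energy_bound_holds`). No definition is introduced.

## Mathlib / tree search

Tree: the two inputs above; `memLp_two_of_lintegral_le`,
`tao2011_boundedTotalSpeed_apriori_unit_of_duhamel`, `tao2011_boundedTotalSpeed_unit_of_apriori`
(`TaoBoundedTotalSpeed`), `tao_finite_energy_smooth_energy_bound_holds` (`NSFiniteEnergySmoothProofs`).
No prior discharge (`lean search 'duhamelNonlinearSpeed_unit_holds|boundedTotalSpeed_unit_holds' --decl`: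
nothing). Mathlib: `eLpNormEssSup_le_of_ae_enorm_bound`, `setLIntegral_congr_fun`,
`setLIntegral_mono'`, `lintegral_const_mul'`.

## References

* T. Tao, *Localisation and compactness properties of the Navier–Stokes global regularity
  problem*, Anal. PDE 6 (2013) 25–107 = arXiv:1108.1165 (`Tao2011`): Prop. 9.1 (arXiv Prop. 52)
  and its proof, §9, pp. 27–28 ((9.2), (9.7)); Lemma 8.1.
-/

noncomputable section

open MeasureTheory Set Function Filter Real
open scoped ENNReal NNReal FourierTransform RealInnerProductSpace ContDiff

namespace Literature.Analysis.FluidPDE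

open UnboundedOperators

section Assembly

variable {T E : ℝ} {u : ℝ → EuclideanSpace ℝ (Fin 3) → EuclideanSpace ℝ (Fin 3)}
  {p : ℝ → EuclideanSpace ℝ (Fin 3) → ℝ}

/-- **Time clamp of a classical solution.** The field `(τ, x) ↦ u(max 0 (min τ T), x)` is jointly
continuous on `ℝ × ℝ³` (the slab solution is jointly continuous on `[0, T] × ℝ³`). [folklore] -/
theorem continuous_uncurry_timeClamp (hT : 0 < T)
    (hsol : IsClassicalNSSolutionOn (Icc 0 T) 1 0 u p) :
    Continuous (uncurry fun τ x => u (max 0 (min τ T)) x) := by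
  have hc : ContinuousOn (uncurry u) (Icc 0 T ×ˢ univ) := hsol.smooth_velocity.continuousOn
  have hcl : Continuous fun τ : ℝ => max 0 (min τ T) :=
    continuous_const.max (continuous_id.min continuous_const)
  have hmem : ∀ τ : ℝ, max 0 (min τ T) ∈ Icc 0 T := fun τ =>
    ⟨le_max_left _ _, max_le hT.le (min_le_right _ _)⟩
  exact hc.comp_continuous ((hcl.comp continuous_fst).prodMk continuous_snd)
    fun z => ⟨hmem z.1, mem_univ _⟩

/-- **The time integral of the Fourier majorant along a classical solution**:
`∫₀ᵀ M(t) dt ≤ (6S/(2π)⁴) ∫₀ᵀ ∫|∇u|²_F` (`lintegral_lintegral_speedMajorant_le` for the clamped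
field, which agrees with `u` on `(0, T)`). [cite: Tao2011, Prop. 9.1 (proof, (9.7) and Schur's test)] -/
theorem lintegral_lintegral_speedMajorant_solution_le (hT : 0 < T)
    (hsol : IsClassicalNSSolutionOn (Icc 0 T) 1 0 u p)
    (hEt : ∀ t ∈ Icc 0 T, ∫⁻ x, ‖u t x‖ₑ ^ 2 ≤ ENNReal.ofReal (2 * E)) :
    ∫⁻ t in Ioo 0 T, ∫⁻ τ in Ioo 0 t, ∑ j, ∑ k,
        ∫⁻ ξ, ‖ξ‖ₑ * ENNReal.ofReal (heatSymbol (t - τ) ξ) *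
          ‖𝓕 (fun x => ((u τ x j * u τ x k : ℝ) : ℂ)) ξ‖ₑ ≤
      ENNReal.ofReal (6 * schurConst / (2 * π) ^ 4) *
        ∫⁻ τ in Ioo 0 T, ∫⁻ x, ENNReal.ofReal (frobeniusNormSq (fderiv ℝ (u τ) x)) := by
  set U : ℝ → EuclideanSpace ℝ (Fin 3) → EuclideanSpace ℝ (Fin 3) :=
    fun τ => u (max 0 (min τ T)) with hU
  have hUeq : ∀ τ ∈ Ioo 0 T, U τ = u τ := fun τ hτ => by
    simp only [hU, min_eq_left hτ.2.le, max_eq_right hτ.1.le]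
  have hUs : ∀ τ ∈ Ioo 0 T, ContDiff ℝ ∞ (U τ) := fun τ hτ => by
    rw [hUeq τ hτ]
    exact hsol.contDiff_velocity ⟨hτ.1.le, hτ.2.le⟩
  have hU2 : ∀ τ ∈ Ioo 0 T, MemLp (U τ) 2 volume := fun τ hτ => by
    rw [hUeq τ hτ]
    exact memLp_two_of_lintegral_le (hsol.contDiff_velocity ⟨hτ.1.le, hτ.2.le⟩).continuous
      (hEt τ ⟨hτ.1.le, hτ.2.le⟩)
  have h := lintegral_lintegral_speedMajorant_le (continuous_uncurry_timeClamp hT hsol) hUs hU2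
  have hL : ∫⁻ t in Ioo 0 T, ∫⁻ τ in Ioo 0 t, ∑ j, ∑ k,
        ∫⁻ ξ, ‖ξ‖ₑ * ENNReal.ofReal (heatSymbol (t - τ) ξ) *
          ‖𝓕 (fun x => ((u τ x j * u τ x k : ℝ) : ℂ)) ξ‖ₑ =
      ∫⁻ t in Ioo 0 T, ∫⁻ τ in Ioo 0 t, ∑ j, ∑ k,
        ∫⁻ ξ, ‖ξ‖ₑ * ENNReal.ofReal (heatSymbol (t - τ) ξ) *
          ‖𝓕 (fun x => ((U τ x j * U τ x k : ℝ) : ℂ)) ξ‖ₑ := by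
    refine setLIntegral_congr_fun measurableSet_Ioo fun t ht => ?_
    refine setLIntegral_congr_fun measurableSet_Ioo fun τ hτ => ?_
    simp only [hUeq τ ⟨hτ.1, hτ.2.trans ht.2⟩]
  have hR : ∫⁻ τ in Ioo 0 T, ∫⁻ x, ENNReal.ofReal (frobeniusNormSq (fderiv ℝ (U τ) x)) =
      ∫⁻ τ in Ioo 0 T, ∫⁻ x, ENNReal.ofReal (frobeniusNormSq (fderiv ℝ (u τ) x)) :=
    setLIntegral_congr_fun measurableSet_Ioo fun τ hτ => by simp only [hUeq τ hτ]
  rw [hL, ← hR]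
  exact h

/-- **The `L^∞` form of the pointwise majorant**: `‖u(t) − e^{tΔ}u(0)‖_{L^∞} ≤ 2π M(t)` for
`t ∈ (0, T]`. [cite: Tao2011, Prop. 9.1 (proof, (9.2)–(9.7))] -/
theorem eLpNorm_sub_heatExtension_le_speedMajorant (hT : 0 < T)
    (hsol : IsClassicalNSSolutionOn (Icc 0 T) 1 0 u p)
    (hfe : ∃ A : ℝ≥0∞, A < ⊤ ∧ ∀ t ∈ Icc 0 T, ∫⁻ x, ‖u t x‖ₑ ^ 2 ≤ A)
    {t : ℝ} (ht : t ∈ Ioc 0 T) :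
    eLpNorm (fun x => u t x - heatExtension (u 0) t x) ∞ volume ≤
      ENNReal.ofReal (2 * π) * ∫⁻ τ in Ioo 0 t, ∑ j, ∑ k,
        ∫⁻ ξ, ‖ξ‖ₑ * ENNReal.ofReal (heatSymbol (t - τ) ξ) *
          ‖𝓕 (fun x => ((u τ x j * u τ x k : ℝ) : ℂ)) ξ‖ₑ := by
  rw [eLpNorm_exponent_top]
  exact eLpNormEssSup_le_of_ae_enorm_bound (Eventually.of_forall fun x =>
    enorm_sub_heatExtension_le_speedMajorant hT hsol hfe ht x)

/-- **Discharge of `tao2011_duhamelNonlinearSpeed_unit`** (Tao 2011, Prop. 9.1, the nonlinear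
Duhamel component; arXiv:1108.1165, Prop. 52, proof pp. 27–28, `ν = 1`, `f = 0`): for a classical
solution on `[0, T] × ℝ³` with `sup_t ∫|u(t)|² ≤ 2E` and `∫₀ᵀ∫|∇u|²_F ≤ E`,
`∫₀ᵀ ‖u(t) − e^{tΔ}u(0)‖_{L^∞} dt ≤ K E` with the absolute constant `K = 6S/(2π)³`,
`S = schurConst`: the `L^∞` majorant integrated in time. [cite: Tao2011, Prop. 9.1 (proof, §9, (9.2) and (9.7)) + Lemma 4.1 (i)] -/
theorem tao2011_duhamelNonlinearSpeed_unit_holds : tao2011_duhamelNonlinearSpeed_unit := by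
  refine ⟨6 * schurConst / (2 * π) ^ 3, by have := schurConst_pos; positivity, ?_⟩
  intro T hT u p hsol E hE hEt hD
  have hfe : ∃ A : ℝ≥0∞, A < ⊤ ∧ ∀ t ∈ Icc 0 T, ∫⁻ x, ‖u t x‖ₑ ^ 2 ≤ A :=
    ⟨_, ENNReal.ofReal_lt_top, hEt⟩
  have hD' : ∫⁻ t in Ioo 0 T, ∫⁻ x, ENNReal.ofReal (frobeniusNormSq (fderiv ℝ (u t) x)) ≤
      ENNReal.ofReal E := by
    simpa only [ENNReal.ofReal_one, one_mul] using hD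
  calc ∫⁻ t in Ioo 0 T, eLpNorm (fun x => u t x - heatExtension (u 0) t x) ∞ volume
      ≤ ∫⁻ t in Ioo 0 T, ENNReal.ofReal (2 * π) * ∫⁻ τ in Ioo 0 t, ∑ j, ∑ k,
          ∫⁻ ξ, ‖ξ‖ₑ * ENNReal.ofReal (heatSymbol (t - τ) ξ) *
            ‖𝓕 (fun x => ((u τ x j * u τ x k : ℝ) : ℂ)) ξ‖ₑ :=
        setLIntegral_mono' measurableSet_Ioo fun t ht =>
          eLpNorm_sub_heatExtension_le_speedMajorant hT hsol hfe ⟨ht.1, ht.2.le⟩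
    _ ≤ ENNReal.ofReal (2 * π) * (ENNReal.ofReal (6 * schurConst / (2 * π) ^ 4) *
          ∫⁻ τ in Ioo 0 T, ∫⁻ x, ENNReal.ofReal (frobeniusNormSq (fderiv ℝ (u τ) x))) := by
        rw [lintegral_const_mul' _ _ ENNReal.ofReal_ne_top]
        exact mul_le_mul' le_rfl (lintegral_lintegral_speedMajorant_solution_le hT hsol hEt)
    _ ≤ ENNReal.ofReal (2 * π) * (ENNReal.ofReal (6 * schurConst / (2 * π) ^ 4) *
          ENNReal.ofReal E) := mul_le_mul' le_rfl (mul_le_mul' le_rfl hD')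
    _ = ENNReal.ofReal (6 * schurConst / (2 * π) ^ 3 * E) := by
        have hS := schurConst_pos
        rw [← ENNReal.ofReal_mul (by positivity), ← ENNReal.ofReal_mul (by positivity)]
        congr 1
        field_simp

/-- **Prop. 9.1 in a priori form (`ν = 1`) holds unconditionally.** [cite: Tao2011, Prop. 9.1 (proof, §9)] -/
theorem tao2011_boundedTotalSpeed_apriori_unit_holds : tao2011_boundedTotalSpeed_apriori_unit :=
  tao2011_boundedTotalSpeed_apriori_unit_of_duhamel tao2011_duhamelNonlinearSpeed_unit_holds

/-- **Tao 2011, Prop. 9.1 (bounded total speed) at unit viscosity holds unconditionally** (the a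
priori form and Lemma 8.1, `tao_finite_energy_smooth_energy_bound_holds`). [cite: Tao2011, Prop. 9.1] -/
theorem tao2011_boundedTotalSpeed_unit_holds : tao2011_boundedTotalSpeed_unit :=
  tao2011_boundedTotalSpeed_unit_of_apriori tao_finite_energy_smooth_energy_bound_holds
    tao2011_boundedTotalSpeed_apriori_unit_holds

end Assembly

end Literature.Analysis.FluidPDE
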